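import Summits.Ventures.PercRepro.SevenThreeLineFreeProfile
import Summits.Ventures.PercRepro.SevenThreeOneLineProfile
import Summits.Ventures.PercRepro.SevenThreeTwoLinesProfile
import Summits.Ventures.PercRepro.SevenThreeTriangleProfile
import Summits.Ventures.PercRepro.SevenThreeKFourProfile
import Summits.Ventures.PercRepro.SevenThreeNaiveDemand
import Summits.Ventures.PercRepro.RLSRuleCorePlaneTypes

/-!
# PercRepro — the `(7,3)` cell, (R6): the per-plane inequality on the positive-type planes of the core (p3, gen 16)

**`perPlane_positive_of_core`** (the statement of record, INBOX 5091): for a core matroid of rank `7` and a plane `G`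
with `ρ(E ∖ G) < 7`, `28/5 · |UqG M 7 3 G| ≤ Σ_{S ∈ Yq M 7 3} fRule M G S / D M S`.  The glue of night-3's chain:
the complement of a plane has rank `≥ 4` (`four_le_eRk_compl_of_plane`, submodularity), so `t := 7 − ρ(E ∖ G) ∈ {1, 2, 3}`;
a core matroid has no line meeting `G` in four points (`no_four_of_core`, from `not_hasLongLine_of_core`); the demand is
p3's `card_UqG_le_naive`; the plane is one of the core's types (`plane_type_of_core`, with its size from
`card_of_plane_type_of_core`), and each type's per-plane inequality is night-3's `perPlane_lineFree` /
`perPlane_oneLine` / `perPlane_twoLines` / `perPlane_triangle` / `perPlane_kFour` on the type's raw conjuncts — the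
bookkeeping here extracts the lines of a `Triangle` / `KFour` (`Finset.card_eq_three`, `card_eq_succ`), shows two
lines of a `6`-point plane meet (`one_le_card_inter_of_third`: a third line cannot lie in the union of two disjoint
ones) and that every point lies on a line (`union_three_eq_of_deg`).  Axioms: standard.
-/

namespace PercRepro

namespace SevenThree

open Finset ThmH SixThree PerFlat NightThree

variable {α : Type*} [DecidableEq α] {M : Matroid α} [M.Finite]

/-- The complement of a plane of a rank-`7` matroid has rank `≥ 4` (submodularity: `7 = ρ(E) ≤ ρ(G) + ρ(E ∖ G)`). -/
theorem four_le_eRk_compl_of_plane (hrank : M.eRank = 7) {G : Finset α} (hG : G ∈ planes M) :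
    (4 : ℕ∞) ≤ M.eRk ((gr M \ G : Finset α) : Set α) := by
  classical
  obtain ⟨hGg, -, hG3⟩ := mem_planes.1 hG
  have hunion : (G : Set α) ∪ ((gr M \ G : Finset α) : Set α) = M.E := by
    rw [← coe_gr M, ← Finset.coe_union, Finset.union_sdiff_of_subset hGg]
  have h := M.eRk_union_le_eRk_add_eRk (G : Set α) ((gr M \ G : Finset α) : Set α)
  rw [hunion, Matroid.eRk_ground, hrank, hG3] at h
  by_contra hlt
  rw [not_le] at hlt
  have h3 : M.eRk ((gr M \ G : Finset α) : Set α) ≤ 3 := by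
    obtain ⟨n, hn⟩ := ENat.ne_top_iff_exists.1 (ne_top_of_lt hlt)
    rw [← hn] at hlt ⊢
    have : n < 4 := by exact_mod_cast hlt
    exact_mod_cast (by omega : n ≤ 3)
  have h6 : (7 : ℕ∞) ≤ 3 + 3 := h.trans (add_le_add_right h3 3)
  norm_num at h6

/-- A core matroid has no line meeting a subset of the ground set in `4` points (`not_hasLongLine_of_core`). -/
theorem no_four_of_core {p : ℕ} (hc : Core M p) {G : Finset α} (hGg : G ⊆ gr M) :
    ∀ L ∈ lines M, (L ∩ G).card ≤ 3 := by
  classical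
  intro L hL
  by_contra h4
  rw [not_le] at h4
  obtain ⟨L4, hL4sub, hL4card⟩ := Finset.exists_subset_card_eq (show 4 ≤ (L ∩ G).card by omega)
  apply not_hasLongLine_of_core hc hGg
  refine ⟨L4, Finset.mem_powersetCard.2 ⟨hL4sub.trans Finset.inter_subset_right, hL4card⟩, ?_⟩
  have := M.eRk_mono (Finset.coe_subset.2 (hL4sub.trans Finset.inter_subset_left) : (L4 : Set α) ⊆ (L : Set α))
  rw [(mem_lines.1 hL).2.2] at this
  exact this

omit [M.Finite] in
/-- Two `3`-point subsets of a `6`-point set meet when a third `3`-point subset meets each of them in at most one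
point: disjoint, they would cover the set and the third would have at most two points. -/
theorem one_le_card_inter_of_third {G l l' l'' : Finset α} (hG6 : G.card = 6) (hl : l ⊆ G) (hl' : l' ⊆ G)
    (hl'' : l'' ⊆ G) (h3 : l.card = 3) (h3' : l'.card = 3) (h3'' : l''.card = 3)
    (hi : (l ∩ l'').card ≤ 1) (hi' : (l' ∩ l'').card ≤ 1) : 1 ≤ (l ∩ l').card := by
  by_contra h0
  rw [not_le, Nat.lt_one_iff] at h0
  have hu := Finset.card_union_add_card_inter l l'
  rw [h0, h3, h3'] at hu
  have heq : l ∪ l' = G :=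
    Finset.eq_of_subset_of_card_le (Finset.union_subset hl hl') (by omega)
  have hsub : l'' ⊆ l ∪ l' := heq ▸ hl''
  have : l''.card ≤ (l'' ∩ l).card + (l'' ∩ l').card := by
    calc l''.card = (l'' ∩ (l ∪ l')).card := by rw [Finset.inter_eq_left.2 hsub]
      _ = ((l'' ∩ l) ∪ (l'' ∩ l')).card := by rw [Finset.inter_union_distrib_left]
      _ ≤ (l'' ∩ l).card + (l'' ∩ l').card := Finset.card_union_le _ _
  rw [Finset.inter_comm l'' l, Finset.inter_comm l'' l'] at this
  omega

omit [M.Finite] in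
/-- Three of the four lines of a plane whose every point lies on exactly two lines cover the plane. -/
theorem union_three_eq_of_deg {G a b c d : Finset α} {L : Finset (Finset α)} (hL : L = {a, b, c, d})
    (hsub : ∀ l ∈ L, l ⊆ G) (hdeg : ∀ v ∈ G, (L.filter (fun l => v ∈ l)).card = 2) :
    a ∪ b ∪ c = G := by
  apply Finset.Subset.antisymm
  · intro v hv
    simp only [Finset.mem_union] at hv
    rcases hv with (hv | hv) | hv
    · exact hsub a (by rw [hL]; simp) hv
    · exact hsub b (by rw [hL]; simp) hv
    · exact hsub c (by rw [hL]; simp) hv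
  · intro v hv
    by_contra hvn
    have hfil : L.filter (fun l => v ∈ l) ⊆ {d} := by
      intro l hl
      rw [Finset.mem_filter, hL] at hl
      rw [Finset.mem_singleton]
      simp only [Finset.mem_insert, Finset.mem_singleton] at hl
      rcases hl.1 with rfl | rfl | rfl | rfl
      · exact absurd (by simp [hl.2] : v ∈ l ∪ b ∪ c) hvn
      · exact absurd (by simp [hl.2] : v ∈ a ∪ l ∪ c) hvn
      · exact absurd (by simp [hl.2] : v ∈ a ∪ b ∪ l) hvn
      · rfl
    have := Finset.card_le_card hfil
    rw [hdeg v hv, Finset.card_singleton] at this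
    omega

/-- **(R6) — the per-plane inequality on the positive-type planes of a core matroid of rank `7`** (the statement
of record, INBOX 5091). -/
theorem perPlane_positive_of_core (hc : Core M 7) {G : Finset α} (hG : G ∈ planes M)
    (hlt : M.eRk ((gr M \ G : Finset α) : Set α) < 7) :
    (28 / 5 : ℚ) * ((UqG M 7 3 G).card : ℚ) ≤ ∑ S ∈ Yq M 7 3, fRule M G S / D M S := by
  classical
  have hs : Simple M := hc.1
  have hrank : M.eRank = 7 := hc.2.1
  have hGg : G ⊆ gr M := (mem_planes.1 hG).1
  have hGq : G ∈ flatsQ M 3 := by rw [flatsQ_three]; exact hG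
  have h4 := four_le_eRk_compl_of_plane hrank hG
  obtain ⟨t, ht1, ht3, ht⟩ : ∃ t : ℕ, 1 ≤ t ∧ t ≤ 3 ∧
      M.eRk ((gr M \ G : Finset α) : Set α) + (t : ℕ∞) = 7 := by
    obtain ⟨n, hn⟩ := ENat.ne_top_iff_exists.1 (ne_top_of_lt hlt)
    rw [← hn] at hlt h4 ⊢
    have hn7 : n < 7 := by exact_mod_cast hlt
    have hn4 : 4 ≤ n := by exact_mod_cast h4
    refine ⟨7 - n, by omega, by omega, ?_⟩
    exact_mod_cast (by omega : n + (7 - n) = 7)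
  have hno4 := no_four_of_core hc hGg
  have hdem := card_UqG_le_naive (M := M) (G := G) ht
  have hsimple : SimpleOn M G := simpleOn_of_core hc hGg
  have hlong : ¬ HasLongLine M G := not_hasLongLine_of_core hc hGg
  -- two distinct `3`-point lines of `G` meet in at most one point
  have hmeet : ∀ {l l' : Finset α}, l ⊆ G → l' ⊆ G → l.card = 3 → l'.card = 3 → M.eRk (l : Set α) = 2 →
      M.eRk (l' : Set α) = 2 → l ≠ l' → (l ∩ l').card ≤ 1 :=
    fun hlG hl'G hl3 hl'3 hlr hl'r hne =>
      card_inter_le_one_of_lines hsimple hlong hGg hlG hl'G hl3 hl'3 hlr hl'r hne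
  rcases plane_type_of_core hc hGq with hLF | ⟨l, hOL⟩ | ⟨l, l', hTL⟩ | hTri | hK4
  · obtain ⟨hg3, hg5⟩ := (card_of_plane_type_of_core hc hGq).1 hLF
    exact perPlane_lineFree hs hrank hG hLF hg3 hg5 ht1 ht3 ht hno4 hdem
  · obtain ⟨hg4, hg5⟩ := (card_of_plane_type_of_core hc hGq).2.1 l hOL
    obtain ⟨hlG, hl3, hlr, hfree⟩ := hOL
    exact perPlane_oneLine hs hrank hG hlG hl3 hlr hfree hg4 hg5 ht1 ht3 ht hno4 hdem
  · obtain ⟨hg5, hg6⟩ := (card_of_plane_type_of_core hc hGq).2.2 l l' hTL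
    have hTL' := hTL
    obtain ⟨hlG, hl'G, hl3, hl'3, hlr, hl'r, hne, -, hfree⟩ := hTL'
    have hint : (l ∩ l').card = 1 := by
      rcases (show G.card = 5 ∨ G.card = 6 by omega) with h5 | h6
      · have hle := hmeet hlG hl'G hl3 hl'3 hlr hl'r hne
        have hu := Finset.card_union_add_card_inter l l'
        have hle5 := Finset.card_le_card (Finset.union_subset hlG hl'G)
        rw [h5] at hle5
        omega
      · exact card_inter_eq_one_of_twoLinesAny_six_core hc hGq hTL h6
    exact perPlane_twoLines hs hrank hG hlG hl'G hl3 hl'3 hlr hl'r hne hint hfree hg5 hg6 ht1 ht3 ht hno4 hdem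
  · obtain ⟨hGc, hLc, hL, hdeg, -, hind⟩ := hTri
    obtain ⟨l₁, l₂, l₃, n12, n13, n23, hLeq⟩ := Finset.card_eq_three.1 hLc
    have m1 : l₁ ∈ depTriples M G := by rw [hLeq]; simp
    have m2 : l₂ ∈ depTriples M G := by rw [hLeq]; simp
    have m3 : l₃ ∈ depTriples M G := by rw [hLeq]; simp
    obtain ⟨s1, h1, r1⟩ := hL l₁ m1
    obtain ⟨s2, h2, r2⟩ := hL l₂ m2
    obtain ⟨s3, h3, r3⟩ := hL l₃ m3
    have i12 := hmeet s1 s2 h1 h2 r1 r2 n12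
    have i13 := hmeet s1 s3 h1 h3 r1 r3 n13
    have i23 := hmeet s2 s3 h2 h3 r2 r3 n23
    have i21 : (l₂ ∩ l₁).card ≤ 1 := by rw [Finset.inter_comm]; exact i12
    have i31 : (l₃ ∩ l₁).card ≤ 1 := by rw [Finset.inter_comm]; exact i13
    have i32 : (l₃ ∩ l₂).card ≤ 1 := by rw [Finset.inter_comm]; exact i23
    have j12 := one_le_card_inter_of_third hGc s1 s2 s3 h1 h2 h3 i13 i23
    have j13 := one_le_card_inter_of_third hGc s1 s3 s2 h1 h3 h2 i12 i32
    have j23 := one_le_card_inter_of_third hGc s2 s3 s1 h2 h3 h1 i21 i31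
    have u12 : (l₁ ∪ l₂).card = 5 := by have := Finset.card_union_add_card_inter l₁ l₂; omega
    have u13 : (l₁ ∪ l₃).card = 5 := by have := Finset.card_union_add_card_inter l₁ l₃; omega
    have u23 : (l₂ ∪ l₃).card = 5 := by have := Finset.card_union_add_card_inter l₂ l₃; omega
    have u123 : l₁ ∪ l₂ ∪ l₃ = G := by
      apply Finset.Subset.antisymm
      · exact Finset.union_subset (Finset.union_subset s1 s2) s3
      · intro v hv
        have hpos : 0 < ((depTriples M G).filter (fun l => v ∈ l)).card := by
          rcases hdeg v hv with h | h <;> omega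
        obtain ⟨l, hl⟩ := Finset.card_pos.1 hpos
        rw [Finset.mem_filter, hLeq] at hl
        simp only [Finset.mem_insert, Finset.mem_singleton] at hl
        simp only [Finset.mem_union]
        rcases hl.1 with rfl | rfl | rfl
        · exact Or.inl (Or.inl hl.2)
        · exact Or.inl (Or.inr hl.2)
        · exact Or.inr hl.2
    have hfree : ∀ T ∈ G.powersetCard 3, T ≠ l₁ → T ≠ l₂ → T ≠ l₃ → M.Indep (T : Set α) := by
      intro T hT hn1 hn2 hn3
      apply hind T hT
      rw [hLeq]
      simp only [Finset.mem_insert, Finset.mem_singleton]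
      tauto
    exact perPlane_triangle hs hrank hG s1 s2 s3 h1 h2 h3 r1 r2 r3 n12 n13 n23 u12 u13 u23 u123 hGc hfree
      ht1 ht3 ht hno4 hdem
  · obtain ⟨hGc, hLc, hL, hdeg, hind⟩ := hK4
    obtain ⟨l₄, L₃, hl₄, hins, hL₃c⟩ := Finset.card_eq_succ.1 hLc
    obtain ⟨l₁, l₂, l₃, n12, n13, n23, hL₃⟩ := Finset.card_eq_three.1 hL₃c
    have hLeq : depTriples M G = {l₁, l₂, l₃, l₄} := by
      rw [← hins, hL₃]
      ext x
      simp only [Finset.mem_insert, Finset.mem_singleton]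
      tauto
    have n14 : l₁ ≠ l₄ := fun h => hl₄ (by rw [hL₃, ← h]; simp)
    have n24 : l₂ ≠ l₄ := fun h => hl₄ (by rw [hL₃, ← h]; simp)
    have n34 : l₃ ≠ l₄ := fun h => hl₄ (by rw [hL₃, ← h]; simp)
    have m1 : l₁ ∈ depTriples M G := by rw [hLeq]; simp
    have m2 : l₂ ∈ depTriples M G := by rw [hLeq]; simp
    have m3 : l₃ ∈ depTriples M G := by rw [hLeq]; simp
    have m4 : l₄ ∈ depTriples M G := by rw [hLeq]; simp
    obtain ⟨s1, h1, r1⟩ := hL l₁ m1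
    obtain ⟨s2, h2, r2⟩ := hL l₂ m2
    obtain ⟨s3, h3, r3⟩ := hL l₃ m3
    obtain ⟨s4, h4', r4⟩ := hL l₄ m4
    have i12 := hmeet s1 s2 h1 h2 r1 r2 n12
    have i13 := hmeet s1 s3 h1 h3 r1 r3 n13
    have i14 := hmeet s1 s4 h1 h4' r1 r4 n14
    have i23 := hmeet s2 s3 h2 h3 r2 r3 n23
    have i24 := hmeet s2 s4 h2 h4' r2 r4 n24
    have i34 := hmeet s3 s4 h3 h4' r3 r4 n34
    have i21 : (l₂ ∩ l₁).card ≤ 1 := by rw [Finset.inter_comm]; exact i12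
    have i31 : (l₃ ∩ l₁).card ≤ 1 := by rw [Finset.inter_comm]; exact i13
    have i41 : (l₄ ∩ l₁).card ≤ 1 := by rw [Finset.inter_comm]; exact i14
    have i32 : (l₃ ∩ l₂).card ≤ 1 := by rw [Finset.inter_comm]; exact i23
    have i42 : (l₄ ∩ l₂).card ≤ 1 := by rw [Finset.inter_comm]; exact i24
    -- each pair meets (a third line witnesses it)
    have j12 := one_le_card_inter_of_third hGc s1 s2 s3 h1 h2 h3 i13 i23
    have j13 := one_le_card_inter_of_third hGc s1 s3 s2 h1 h3 h2 i12 i32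
    have j14 := one_le_card_inter_of_third hGc s1 s4 s2 h1 h4' h2 i12 i42
    have j23 := one_le_card_inter_of_third hGc s2 s3 s1 h2 h3 h1 i21 i31
    have j24 := one_le_card_inter_of_third hGc s2 s4 s1 h2 h4' h1 i21 i41
    have j34 := one_le_card_inter_of_third hGc s3 s4 s1 h3 h4' h1 i31 i41
    have u12 : (l₁ ∪ l₂).card = 5 := by have := Finset.card_union_add_card_inter l₁ l₂; omega
    have u13 : (l₁ ∪ l₃).card = 5 := by have := Finset.card_union_add_card_inter l₁ l₃; omega
    have u14 : (l₁ ∪ l₄).card = 5 := by have := Finset.card_union_add_card_inter l₁ l₄; omega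
    have u23 : (l₂ ∪ l₃).card = 5 := by have := Finset.card_union_add_card_inter l₂ l₃; omega
    have u24 : (l₂ ∪ l₄).card = 5 := by have := Finset.card_union_add_card_inter l₂ l₄; omega
    have u34 : (l₃ ∪ l₄).card = 5 := by have := Finset.card_union_add_card_inter l₃ l₄; omega
    have hsub : ∀ l ∈ depTriples M G, l ⊆ G := fun l hl => (hL l hl).1
    have hLeq2 : depTriples M G = {l₁, l₂, l₄, l₃} := by rw [hLeq, Finset.pair_comm l₃ l₄]
    have hLeq3 : depTriples M G = {l₁, l₃, l₄, l₂} := by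
      rw [hLeq, Finset.insert_comm l₂ l₃, Finset.pair_comm l₂ l₄]
    have hLeq4 : depTriples M G = {l₂, l₃, l₄, l₁} := by
      rw [hLeq, Finset.insert_comm l₁ l₂, Finset.insert_comm l₁ l₃, Finset.pair_comm l₁ l₄]
    have t123 := union_three_eq_of_deg hLeq hsub hdeg
    have t124 := union_three_eq_of_deg hLeq2 hsub hdeg
    have t134 := union_three_eq_of_deg hLeq3 hsub hdeg
    have t234 := union_three_eq_of_deg hLeq4 hsub hdeg
    have hfree : ∀ T ∈ G.powersetCard 3, T ≠ l₁ → T ≠ l₂ → T ≠ l₃ → T ≠ l₄ → M.Indep (T : Set α) := by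
      intro T hT hn1 hn2 hn3 hn4
      apply hind T hT
      rw [hLeq]
      simp only [Finset.mem_insert, Finset.mem_singleton]
      tauto
    exact perPlane_kFour hs hrank hG s1 s2 s3 s4 h1 h2 h3 h4' r1 r2 r3 r4 n12 n13 n14 n23 n24 n34
      u12 u13 u14 u23 u24 u34 t123 t124 t134 t234 hGc hfree ht1 ht3 ht hno4 hdem

end SevenThree

end PercRepro
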